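import Summits.NavierStokesRegularity.NavierStokesRegularity.Theorems.IsobarTomographyIsobaricLinesLiouvilleHullReduction
import Summits.NavierStokesRegularity.NavierStokesRegularity.Theorems.IsobarTomographyIsobaricLinesLiouvilleStubScrewLeaf
import Summits.NavierStokesRegularity.NavierStokesRegularity.Theorems.IsobarTomographyIsobaricLinesLiouvilleStubDivFormLiouville
import Summits.NavierStokesRegularity.NavierStokesRegularity.Theorems.IsobarTomographyIsobaricLinesLiouvilleStubNoStretchData
import HarnessLib

/-!
# Five-hull reduction for the crux `IsobaricLinesLiouville` (stmt-NavierStokesRegularity-11741), line `Ideator2Sketch` (v6)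

Lead file (continuation lead c2; supports the crux). The hull list of `…HullReduction` — (A) vorticity
along one fixed vector, (B) velocity invariant along one fixed direction, (C) infinitesimal
axisymmetry without swirl — is completed by the third conjugacy type of Killing symmetry and by the
weakest hypothesis under which the maximum-principle engine of KNSS 2009 runs with no symmetry:

* (D) SCREW hull — vorticity along a screw field `x ↦ a × (x − c) + b`, `⟪a, b⟫ ≠ 0`, no screw swirl;
  its leaf is the landed `stub_screwLeaf` (swirl-source identity, elementary);
* (E) STRETCH-FREE hull — two fixed directions `e₁, e₂`, `e₁ × e₂ ≠ 0`, whose velocity components are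
  constant along vortex lines (`ω·∇⟪v,eᵢ⟫ ≡ 0`); its leaf is assembled here:
  `stretchFreeComponent` (= `stub_noStretchData` fed into `stub_divFormLiouville`: a vorticity
  component without stretching solves the drift–heat equation, is the divergence of the bounded field
  `v × e`, hence vanishes by Lemma 2.1 + the surface estimate — the n-dimensional core of the proof of
  KNSS Thm 5.1), then `parallel_cross_of_inner_eq_zero` puts `ω` along `e₁ × e₂`, which is hull (A).

`isobaricLinesLiouville_of_hull5` / `hull5_of_isobaricLinesLiouville`: the five-hull form of the
line's one open stub `stub_hullRigidity` (v6) implies the crux and is implied by it — it is still exactly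
crux-sized, but every symmetric or engine-closable sub-class is now a theorem of the tree.
Sources: Koch–Nadirashvili–Seregin–Šverák 2009 (arXiv:0709.3599) Lemma 2.1, Thms 5.1–5.2.
-/

noncomputable section

-- the summit and its single problem share the name (D-0017 nested layout)
set_option linter.dupNamespace false

namespace Summit.NavierStokesRegularity.NavierStokesRegularity.Theorems.IsobaricLinesLiouville.FluxSurfacePersistence

open scoped InnerProductSpace RealInnerProductSpace Topology ContDiff Laplacian Matrix
open Literature.Analysis.FluidPDE Set Filter MeasureTheory Function WithLp
open Summit.NavierStokesRegularity.NavierStokesRegularity.Theses.IsobarTomography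

/-! ### Hull (E): the stretch-free component and the linear algebra -/

/-- **Stretch-free component** (engine of hull (E)): for a bounded ancient mild solution (classical
on `(-∞,0)`) and a fixed vector `e`, if `⟪v, e⟫` is constant along vortex lines at all `t < 0`
(`ω·∇⟪v,e⟫ ≡ 0`: no stretching of `θ = ⟪ω, e⟫`), then `⟪ω, e⟫ ≡ 0` — `stub_noStretchData` (the
Lemma-2.1 data of `θ` and `θ = div (v × e)`) fed into `stub_divFormLiouville`. -/
theorem stretchFreeComponent
    (v : ℝ → (EuclideanSpace ℝ (Fin 3)) → (EuclideanSpace ℝ (Fin 3)))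
    (q : ℝ → (EuclideanSpace ℝ (Fin 3)) → ℝ)
    (hanc : IsBoundedAncientMildSolution 1 v) (hcl : IsClassicalNSSolutionOn (Set.Iio 0) 1 0 v q)
    (e : EuclideanSpace ℝ (Fin 3))
    (hns : ∀ t < 0, ∀ x : EuclideanSpace ℝ (Fin 3),
      ⟪curl (v t) x, gradient (fun y => ⟪v t y, e⟫_ℝ) x⟫_ℝ = 0) :
    ∀ t < 0, ∀ x : EuclideanSpace ℝ (Fin 3), ⟪curl (v t) x, e⟫_ℝ = 0 := by
  obtain ⟨a, A, K, ha, haA, hb, h2, hD, hcD, hcΔ, heq, hrep⟩ :=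
    stub_noStretchData v q hanc hcl e hns
  exact stub_divFormLiouville (fun t y => ⟪curl (v t) y, e⟫_ℝ) a A K ha haA hb h2 hD hcD hcΔ heq hrep

/-- A vector of `ℝ³` orthogonal to `e₁` and `e₂`, with `e₁ × e₂ ≠ 0`, is a multiple of `e₁ × e₂`
(Lagrange: `n × (n × w) = ⟪n,w⟫ n − ‖n‖² w` and `(e₁ × e₂) × w = ⟪e₁,w⟫ e₂ − ⟪e₂,w⟫ e₁ = 0`). -/
theorem parallel_cross_of_inner_eq_zero {e₁ e₂ w : EuclideanSpace ℝ (Fin 3)} (hn : cross e₁ e₂ ≠ 0)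
    (h₁ : ⟪w, e₁⟫_ℝ = 0) (h₂ : ⟪w, e₂⟫_ℝ = 0) : ∃ μ : ℝ, w = μ • cross e₁ e₂ := by
  set N : Fin 3 → ℝ := ofLp e₁ ⨯₃ ofLp e₂ with hN
  have hn' : ofLp (cross e₁ e₂) = N := rfl
  -- `(e₁ × e₂) × w = ⟪e₁,w⟫ e₂ − ⟪e₂,w⟫ e₁ = 0`
  have h₁' : ofLp e₁ ⬝ᵥ ofLp w = 0 := by rw [dotProduct_ofLp, real_inner_comm]; exact h₁
  have h₂' : ofLp e₂ ⬝ᵥ ofLp w = 0 := by rw [dotProduct_ofLp, real_inner_comm]; exact h₂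
  have hNW : N ⨯₃ ofLp w = 0 := by
    rw [hN, cross_cross_eq_smul_sub_smul, h₁', h₂', zero_smul, zero_smul, sub_zero]
  -- Lagrange: `N × (N × w) = ⟪N,w⟫ N − ⟪N,N⟫ w`
  have hlag : (N ⬝ᵥ ofLp w) • N - (N ⬝ᵥ N) • ofLp w = 0 := by
    rw [← cross_cross_eq_smul_sub_smul', hNW, map_zero]
  have hNN : N ⬝ᵥ N ≠ 0 := by
    rw [← hn', dotProduct_ofLp]
    exact inner_self_ne_zero.2 hn
  refine ⟨(N ⬝ᵥ ofLp w) / (N ⬝ᵥ N), (WithLp.ofLp_injective 2) ?_⟩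
  rw [WithLp.ofLp_smul, hn']
  have key : (N ⬝ᵥ N) • ofLp w = (N ⬝ᵥ ofLp w) • N := (sub_eq_zero.1 hlag).symm
  calc ofLp w = (N ⬝ᵥ N)⁻¹ • ((N ⬝ᵥ N) • ofLp w) := by
        rw [smul_smul, inv_mul_cancel₀ hNN, one_smul]
    _ = (N ⬝ᵥ ofLp w / (N ⬝ᵥ N)) • N := by
        rw [key, smul_smul, div_eq_inv_mul]

/-- **Stretch-free leaf** (hull (E)): a bounded ancient mild solution (classical on `(-∞,0)`) with
two fixed directions `e₁, e₂`, `e₁ × e₂ ≠ 0`, whose velocity components are constant along vortex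
lines at all `t < 0`, is constant on every slice: both components of `ω` vanish
(`stretchFreeComponent`), so `ω ∥ e₁ × e₂` (`parallel_cross_of_inner_eq_zero`) and the
unidirectional-vorticity leaf `sliceConst_of_curl_parallel` (KNSS Thm 5.1) concludes. -/
theorem sliceConst_of_twoStretchFree
    (v : ℝ → (EuclideanSpace ℝ (Fin 3)) → (EuclideanSpace ℝ (Fin 3)))
    (q : ℝ → (EuclideanSpace ℝ (Fin 3)) → ℝ)
    (hanc : IsBoundedAncientMildSolution 1 v) (hcl : IsClassicalNSSolutionOn (Set.Iio 0) 1 0 v q)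
    (e₁ e₂ : EuclideanSpace ℝ (Fin 3)) (hn : cross e₁ e₂ ≠ 0)
    (h : ∀ t < 0, ∀ x : EuclideanSpace ℝ (Fin 3),
      ⟪curl (v t) x, gradient (fun y => ⟪v t y, e₁⟫_ℝ) x⟫_ℝ = 0 ∧
      ⟪curl (v t) x, gradient (fun y => ⟪v t y, e₂⟫_ℝ) x⟫_ℝ = 0) :
    ∀ t < 0, ∃ b : EuclideanSpace ℝ (Fin 3), v t = fun _ => b := by
  have h1 := stretchFreeComponent v q hanc hcl e₁ (fun t ht x => (h t ht x).1)
  have h2 := stretchFreeComponent v q hanc hcl e₂ (fun t ht x => (h t ht x).2)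
  exact sliceConst_of_curl_parallel v q hanc hcl (cross e₁ e₂)
    (fun t ht x => parallel_cross_of_inner_eq_zero hn (h1 t ht x) (h2 t ht x))

/-! ### The five-hull reduction and its converse -/

/-- **Five-hull rigidity implies the crux.** If every isobaric bounded ancient mild solution
satisfying the persistence identity, the twist identity and the Newcomb integrals lies in one of
the hulls (A) unidirectional vorticity, (B) invariance along a direction, (C) infinitesimal
axisymmetry without swirl, (D) vorticity along a screw field without screw swirl, (E) two
independent stretch-free directions — then `IsobaricLinesLiouville` holds: the three extra
hypotheses are theorems on the class (`persistence_identity`, `twist_identity_isobaric`,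
`stub_newcombClosedLine`) and each hull is slice-wise constant (`sliceConst_of_curl_parallel`,
`sliceConst_of_translationInvariant`, `sliceConst_of_axisym`, `stub_screwLeaf`,
`sliceConst_of_twoStretchFree`). This is the composition of line `Ideator2Sketch` (v6) with its
one open stub as hypothesis. -/
theorem isobaricLinesLiouville_of_hull5 :
    (∀ (v : ℝ → (EuclideanSpace ℝ (Fin 3)) → (EuclideanSpace ℝ (Fin 3)))
      (q : ℝ → (EuclideanSpace ℝ (Fin 3)) → ℝ),
      IsBoundedAncientMildSolution 1 v → IsClassicalNSSolutionOn (Set.Iio 0) 1 0 v q →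
      (∀ t < 0, ∀ x : EuclideanSpace ℝ (Fin 3), ⟪curl (v t) x, gradient (q t) x⟫_ℝ = 0) →
      (∀ t < 0, ∀ x : EuclideanSpace ℝ (Fin 3),
        ⟪curl (v t) x,
            gradient (fun y => timeDerivWithin (Set.Iio 0) q t y + ⟪v t y, gradient (q t) y⟫_ℝ) x⟫_ℝ
          = - ⟪(Δ (curl (v t))) x, gradient (q t) x⟫_ℝ) →
      (∀ t < 0, ∀ x : EuclideanSpace ℝ (Fin 3),
        ⟪curl (v t) x, timeDerivWithin (Set.Iio 0) v t x⟫_ℝ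
          + ⟪curl (v t) x, gradient (fun y => ‖v t y‖ ^ 2 / 2) x⟫_ℝ
          + ⟪curl (v t) x, curl (curl (v t)) x⟫_ℝ = 0) →
      (∀ t < 0, ∀ (γ : ℝ → EuclideanSpace ℝ (Fin 3)) (T : ℝ), 0 < T →
        (∀ s, HasDerivAt γ (curl (v t) (γ s)) s) → Function.Periodic γ T →
          ∫ s in (0 : ℝ)..T, ⟪(Δ (curl (v t))) (γ s), gradient (q t) (γ s)⟫_ℝ = 0) →
      (∃ a : EuclideanSpace ℝ (Fin 3), ∀ t < 0, ∀ x : EuclideanSpace ℝ (Fin 3),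
          ∃ μ : ℝ, curl (v t) x = μ • a) ∨
      (∃ a : EuclideanSpace ℝ (Fin 3), a ≠ 0 ∧ ∀ t < 0, ∀ (x : EuclideanSpace ℝ (Fin 3)) (δ : ℝ),
          v t (x + δ • a) = v t x) ∨
      (∃ e c : EuclideanSpace ℝ (Fin 3), e ≠ 0 ∧ ∀ t < 0, ∀ x : EuclideanSpace ℝ (Fin 3),
          fderiv ℝ (v t) x (cross e (x - c)) = cross e (v t x) ∧ ⟪v t x, cross e (x - c)⟫_ℝ = 0) ∨
      (∃ a b c : EuclideanSpace ℝ (Fin 3), ⟪a, b⟫_ℝ ≠ 0 ∧ ∀ t < 0, ∀ x : EuclideanSpace ℝ (Fin 3),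
          cross (curl (v t) x) (cross a (x - c) + b) = 0 ∧ ⟪v t x, cross a (x - c) + b⟫_ℝ = 0) ∨
      (∃ e₁ e₂ : EuclideanSpace ℝ (Fin 3), cross e₁ e₂ ≠ 0 ∧ ∀ t < 0, ∀ x : EuclideanSpace ℝ (Fin 3),
          ⟪curl (v t) x, gradient (fun y => ⟪v t y, e₁⟫_ℝ) x⟫_ℝ = 0 ∧
          ⟪curl (v t) x, gradient (fun y => ⟪v t y, e₂⟫_ℝ) x⟫_ℝ = 0)) →
    IsobaricLinesLiouville := by
  intro hull v q hanc hcl hiso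
  have hP := persistence_identity v q hcl hiso
  have hT := twist_identity_isobaric v q hcl hiso
  have hN := stub_newcombClosedLine v q hcl hP
  rcases hull v q hanc hcl hiso hP hT hN with
    ⟨a, h⟩ | ⟨a, ha, h⟩ | ⟨e, c, he, h⟩ | ⟨a, b, c, hab, h⟩ | ⟨e₁, e₂, hn, h⟩
  · exact sliceConst_of_curl_parallel v q hanc hcl a h
  · exact sliceConst_of_translationInvariant v q hanc hcl a ha h
  · exact sliceConst_of_axisym v q hanc hcl e c he (fun t ht x => (h t ht x).1)
      (fun t ht x => (h t ht x).2)
  · exact stub_screwLeaf v q hanc hcl hiso a b c hab h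
  · exact sliceConst_of_twoStretchFree v q hanc hcl e₁ e₂ hn h

/-- **The crux implies five-hull rigidity** (so the open stub of line `Ideator2Sketch`, v6, is
still EQUIVALENT to the crux): constant slices have vanishing vorticity (`curl_const_eq_zero`),
which is hull (A) with `a = 0`. -/
theorem hull5_of_isobaricLinesLiouville :
    IsobaricLinesLiouville → ∀ (v : ℝ → (EuclideanSpace ℝ (Fin 3)) → (EuclideanSpace ℝ (Fin 3)))
      (q : ℝ → (EuclideanSpace ℝ (Fin 3)) → ℝ),
      IsBoundedAncientMildSolution 1 v → IsClassicalNSSolutionOn (Set.Iio 0) 1 0 v q →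
      (∀ t < 0, ∀ x : EuclideanSpace ℝ (Fin 3), ⟪curl (v t) x, gradient (q t) x⟫_ℝ = 0) →
      (∀ t < 0, ∀ x : EuclideanSpace ℝ (Fin 3),
        ⟪curl (v t) x,
            gradient (fun y => timeDerivWithin (Set.Iio 0) q t y + ⟪v t y, gradient (q t) y⟫_ℝ) x⟫_ℝ
          = - ⟪(Δ (curl (v t))) x, gradient (q t) x⟫_ℝ) →
      (∀ t < 0, ∀ x : EuclideanSpace ℝ (Fin 3),
        ⟪curl (v t) x, timeDerivWithin (Set.Iio 0) v t x⟫_ℝ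
          + ⟪curl (v t) x, gradient (fun y => ‖v t y‖ ^ 2 / 2) x⟫_ℝ
          + ⟪curl (v t) x, curl (curl (v t)) x⟫_ℝ = 0) →
      (∀ t < 0, ∀ (γ : ℝ → EuclideanSpace ℝ (Fin 3)) (T : ℝ), 0 < T →
        (∀ s, HasDerivAt γ (curl (v t) (γ s)) s) → Function.Periodic γ T →
          ∫ s in (0 : ℝ)..T, ⟪(Δ (curl (v t))) (γ s), gradient (q t) (γ s)⟫_ℝ = 0) →
      (∃ a : EuclideanSpace ℝ (Fin 3), ∀ t < 0, ∀ x : EuclideanSpace ℝ (Fin 3),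
          ∃ μ : ℝ, curl (v t) x = μ • a) ∨
      (∃ a : EuclideanSpace ℝ (Fin 3), a ≠ 0 ∧ ∀ t < 0, ∀ (x : EuclideanSpace ℝ (Fin 3)) (δ : ℝ),
          v t (x + δ • a) = v t x) ∨
      (∃ e c : EuclideanSpace ℝ (Fin 3), e ≠ 0 ∧ ∀ t < 0, ∀ x : EuclideanSpace ℝ (Fin 3),
          fderiv ℝ (v t) x (cross e (x - c)) = cross e (v t x) ∧ ⟪v t x, cross e (x - c)⟫_ℝ = 0) ∨
      (∃ a b c : EuclideanSpace ℝ (Fin 3), ⟪a, b⟫_ℝ ≠ 0 ∧ ∀ t < 0, ∀ x : EuclideanSpace ℝ (Fin 3),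
          cross (curl (v t) x) (cross a (x - c) + b) = 0 ∧ ⟪v t x, cross a (x - c) + b⟫_ℝ = 0) ∨
      (∃ e₁ e₂ : EuclideanSpace ℝ (Fin 3), cross e₁ e₂ ≠ 0 ∧ ∀ t < 0, ∀ x : EuclideanSpace ℝ (Fin 3),
          ⟪curl (v t) x, gradient (fun y => ⟪v t y, e₁⟫_ℝ) x⟫_ℝ = 0 ∧
          ⟪curl (v t) x, gradient (fun y => ⟪v t y, e₂⟫_ℝ) x⟫_ℝ = 0) := by
  intro hL v q hanc hcl hiso _ _ _
  left
  refine ⟨0, fun t ht x => ⟨0, ?_⟩⟩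
  obtain ⟨b, hb⟩ := hL v q hanc hcl hiso t ht
  rw [hb, curl_const_eq_zero, zero_smul]

end Summit.NavierStokesRegularity.NavierStokesRegularity.Theorems.IsobaricLinesLiouville.FluxSurfacePersistence

end
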